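import Mathlib

/-!
# Stub `stub_levelKNoRadicalMiddle` — line `ghost-calculus-chebotarev` of the crux
`SubgroupIdentityDesigns` (stmt-MatrixMultiplication-14079)

Crux
`Summit.MatrixMultiplication.MatrixMultiplication.Theses.LevelGradedCohnUmans.SubgroupIdentityDesigns`;
this file proves the registered NEGATIVE helper `stub_levelKNoRadicalMiddle` verbatim (name +
signature): for `m > 2k` no middle group of a level-`k` sandwich design contains a full unipotent
radical `U_W` of the stabiliser of a proper nonzero subspace `W ≤ 𝔽_p^m` (this kills the
three-parabolic families).  Pure linear algebra, no Fourier analysis.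

Setting.  `V = Fin m → 𝔽_p`, `H₂ ≤ GL_m(𝔽_p)` subject to CORNER AVOIDANCE: every `b ∈ H₂`,
`b ≠ 1`, has a nonzero entry of `b - 1` inside the top-left `k × k` block.  `W` is a submodule
with `W ≠ ⊥`, `W ≠ ⊤`, and the RADICAL hypothesis says that every unit `b` acting trivially on
`W` and on `V / W` (`b w = w` for `w ∈ W`, `b x - x ∈ W` for all `x`) lies in `H₂`.  Conclusion:
`False`.

Proof.  It suffices to exhibit a unit `b = 1 + n` with `n x = f(x) • w₀`, where `w₀ ∈ W ∖ 0` and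
`f` is a nonzero functional vanishing on `W`, such that the top-left `k × k` block of
`n = (f(e_j) w₀ᵢ)ᵢⱼ` vanishes: `n² = f(w₀) n = 0` makes `b` a unit with inverse `1 - n`, `b`
fixes `W` pointwise and moves every vector by an element of `W`, so `b ∈ H₂` by the radical
hypothesis, while `b ≠ 1` (as `f ≠ 0`, `w₀ ≠ 0`) and `b - 1 = n` has zero top-left block,
contradicting corner avoidance.  The pair `(w₀, f)`: if some nonzero `w₀ ∈ W` vanishes on the
coordinates `< k`, take it and any nonzero `f ⊇ W` in its kernel (`W ≠ ⊤`); otherwise the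
projection of `W` to the first `k` coordinates is injective, so `dim W ≤ k`, and with
`E = ⟨e_j : j < k⟩` we get `dim (E ⊔ W) ≤ 2k < m`, whence a nonzero `f` killing `E ⊔ W`; take any
nonzero `w₀ ∈ W` (`W ≠ ⊥`); then `f(e_j) = 0` for `j < k`.  Sorry-free; standard axioms.
-/

set_option linter.dupNamespace false

noncomputable section

open scoped BigOperators

namespace Summit.MatrixMultiplication.MatrixMultiplication.Theorems.SubgroupIdentityDesigns.Negative

namespace NoRadicalMiddle

/-! ## The rank-one nilpotent matrix `x ↦ f(x) • w₀` -/

/-- **Rank-one nilpotent.**  For a functional `f` and a vector `w₀` with `f w₀ = 0`, the matrix `n`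
of `x ↦ f x • w₀` satisfies `n x = f x • w₀`, has entries `n i j = f(e_j) * w₀ i`, and `n² = 0`.
[folklore] -/
theorem exists_rankOne_nilpotent {K : Type*} [Field K] {m : ℕ}
    (f : Module.Dual K (Fin m → K)) (w₀ : Fin m → K) (hfw₀ : f w₀ = 0) :
    ∃ n : Matrix (Fin m) (Fin m) K,
      (∀ x : Fin m → K, n.mulVec x = f x • w₀) ∧
      (∀ i j : Fin m, n i j = f (Pi.single j 1) * w₀ i) ∧
      n * n = 0 := by
  have hφ : ∀ x, (f.smulRight w₀) x = f x • w₀ := fun x => LinearMap.smulRight_apply f w₀ x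
  have hφφ : f.smulRight w₀ * f.smulRight w₀ = 0 :=
    LinearMap.ext fun x => by simp [Module.End.mul_apply, hφ, hfw₀]
  refine ⟨LinearMap.toMatrix' (f.smulRight w₀), fun x => ?_, fun i j => ?_, ?_⟩
  · rw [LinearMap.toMatrix'_mulVec, hφ]
  · rw [LinearMap.toMatrix'_apply, hφ, Pi.smul_apply, smul_eq_mul]
  · rw [← LinearMap.toMatrix'_mul, hφφ, map_zero]

/-! ## The radical element with vanishing top-left block -/

/-- **Radical transvection.**  Given `w₀ ∈ W ∖ 0` and a nonzero functional `f` vanishing on `W`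
such that `f(e_j) * w₀ i = 0` on the top-left `k × k` block, the unit `b = 1 + n`
(`n x = f x • w₀`, inverse `1 - n`) fixes `W` pointwise, moves every vector by an element of `W`,
is not the identity, and `b - 1` vanishes on the top-left block. [folklore] -/
theorem exists_radical_elem {K : Type*} [Field K] {m : ℕ} (k : ℕ)
    (W : Submodule K (Fin m → K)) {w₀ : Fin m → K} (hw₀W : w₀ ∈ W) (hw₀ : w₀ ≠ 0)
    {f : Module.Dual K (Fin m → K)} (hf : f ≠ 0) (hfW : W ≤ LinearMap.ker f)
    (hblock : ∀ i j : Fin m, i.val < k → j.val < k → f (Pi.single j 1) * w₀ i = 0) :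
    ∃ b : Matrix.GeneralLinearGroup (Fin m) K,
      (∀ w ∈ W, (b : Matrix (Fin m) (Fin m) K).mulVec w = w) ∧
      (∀ x : Fin m → K, (b : Matrix (Fin m) (Fin m) K).mulVec x - x ∈ W) ∧
      b ≠ 1 ∧
      ∀ i j : Fin m, i.val < k → j.val < k → ((b : Matrix (Fin m) (Fin m) K) - 1) i j = 0 := by
  obtain ⟨n, hn_mulVec, hn_apply, hn_sq⟩ :=
    exists_rankOne_nilpotent f w₀ (LinearMap.mem_ker.mp (hfW hw₀W))
  have h1 : (1 + n) * (1 - n) = 1 := by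
    rw [add_mul, one_mul, mul_sub, mul_one, hn_sq, sub_zero, sub_add_cancel]
  have h2 : (1 - n) * (1 + n) = 1 := by
    rw [sub_mul, one_mul, mul_add, mul_one, hn_sq, add_zero, add_sub_cancel_right]
  refine ⟨⟨1 + n, 1 - n, h1, h2⟩, ?_, ?_, ?_, ?_⟩
  · intro w hw
    change (1 + n).mulVec w = w
    rw [Matrix.add_mulVec, Matrix.one_mulVec, hn_mulVec, LinearMap.mem_ker.mp (hfW hw), zero_smul,
      add_zero]
  · intro x
    change (1 + n).mulVec x - x ∈ W
    rw [Matrix.add_mulVec, Matrix.one_mulVec, hn_mulVec, add_sub_cancel_left]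
    exact W.smul_mem _ hw₀W
  · intro hb
    have hval := congrArg (fun u : Matrix.GeneralLinearGroup (Fin m) K => (u : Matrix (Fin m) (Fin m) K)) hb
    have hn0 : n = 0 := by simpa using hval
    refine hf (LinearMap.ext fun x => ?_)
    have hx := hn_mulVec x
    rw [hn0, Matrix.zero_mulVec] at hx
    exact ((smul_eq_zero.mp hx.symm).resolve_right hw₀)
  · intro i j hi hj
    change (1 + n - 1) i j = 0
    rw [add_sub_cancel_left, hn_apply]
    exact hblock i j hi hj

/-! ## The adapted pair `(w₀, f)` -/

/-- **Adapted pair.**  If `2k < m` and `W` is a proper nonzero subspace of `K^m`, there are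
`w₀ ∈ W ∖ 0` and a nonzero functional `f` vanishing on `W` with `f(e_j) * w₀ i = 0` on the whole
top-left `k × k` block: either some nonzero `w₀ ∈ W` vanishes on the coordinates `< k` (take any
`f`), or `W` projects injectively to the first `k` coordinates, `dim W ≤ k`,
`dim (⟨e_j : j < k⟩ ⊔ W) ≤ 2k < m`, and `f` may be chosen to kill `e_j`, `j < k`, as well.
[folklore] -/
theorem exists_adapted_pair {K : Type*} [Field K] {m k : ℕ} (hkm : 2 * k < m)
    {W : Submodule K (Fin m → K)} (hbot : W ≠ ⊥) (htop : W ≠ ⊤) :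
    ∃ w₀ ∈ W, w₀ ≠ 0 ∧ ∃ f : Module.Dual K (Fin m → K), f ≠ 0 ∧ W ≤ LinearMap.ker f ∧
      ∀ i j : Fin m, i.val < k → j.val < k → f (Pi.single j 1) * w₀ i = 0 := by
  by_cases hcase : ∃ w ∈ W, w ≠ 0 ∧ ∀ i : Fin m, i.val < k → w i = 0
  · -- Case 1: a nonzero vector of `W` supported on the coordinates `≥ k`.
    obtain ⟨w₀, hw₀W, hw₀, hsupp⟩ := hcase
    obtain ⟨f, hf, hfW⟩ := Submodule.exists_le_ker_of_lt_top W (lt_top_iff_ne_top.mpr htop)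
    exact ⟨w₀, hw₀W, hw₀, f, hf, hfW, fun i j hi _ => by rw [hsupp i hi, mul_zero]⟩
  · -- Case 2: `W` projects injectively to the first `k` coordinates.
    push Not at hcase
    have hkm' : k ≤ m := by omega
    have hinj : Function.Injective
        ((LinearMap.funLeft K K (Fin.castLE hkm')).comp W.subtype) := by
      rw [injective_iff_map_eq_zero]
      rintro ⟨w, hw⟩ hzero
      have hw0 : ∀ i : Fin m, i.val < k → w i = 0 := fun i hi => by
        have hi' := congrFun hzero ⟨i.val, hi⟩
        have hcast : Fin.castLE hkm' ⟨i.val, hi⟩ = i := Fin.ext rfl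
        simpa [LinearMap.funLeft_apply, hcast] using hi'
      by_contra hne
      obtain ⟨i, hi, hwi⟩ := hcase w hw (fun h => hne ((Submodule.mk_eq_zero W hw).mpr h))
      exact hwi (hw0 i hi)
    have hW : Module.finrank K W ≤ k := by
      have := LinearMap.finrank_le_finrank_of_injective hinj
      rwa [Module.finrank_fin_fun] at this
    set E : Submodule K (Fin m → K) :=
      Submodule.span K (Set.range fun j : Fin k => (Pi.single (Fin.castLE hkm' j) (1 : K) : Fin m → K))
      with hE_def
    have hE : Module.finrank K E ≤ k := by
      have := finrank_range_le_card (R := K)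
        (fun j : Fin k => (Pi.single (Fin.castLE hkm' j) (1 : K) : Fin m → K))
      simpa [Set.finrank] using this
    have hlt : E ⊔ W < ⊤ := by
      apply Submodule.lt_top_of_finrank_lt_finrank
      calc Module.finrank K ↥(E ⊔ W) ≤ Module.finrank K E + Module.finrank K W :=
            Submodule.finrank_add_le_finrank_add_finrank E W
        _ ≤ k + k := add_le_add hE hW
        _ < m := by omega
        _ = Module.finrank K (Fin m → K) := (Module.finrank_fin_fun K).symm
    obtain ⟨f, hf, hfEW⟩ := Submodule.exists_le_ker_of_lt_top _ hlt
    obtain ⟨w₀, hw₀W, hw₀⟩ := Submodule.exists_mem_ne_zero_of_ne_bot hbot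
    refine ⟨w₀, hw₀W, hw₀, f, hf, le_sup_right.trans hfEW, fun i j _ hj => ?_⟩
    have hjE : (Pi.single j 1 : Fin m → K) ∈ E :=
      Submodule.subset_span ⟨⟨j.val, hj⟩, by simp⟩
    rw [LinearMap.mem_ker.mp (hfEW (Submodule.mem_sup_left hjE)), zero_mul]

end NoRadicalMiddle

open NoRadicalMiddle in
/-- **No radical middle at level `k`** (negative helper for the line `ghost-calculus-chebotarev` of
the crux `SubgroupIdentityDesigns`).  Let `2k < m` and let `H₂ ≤ GL_m(𝔽_p)` satisfy corner
avoidance: every `b ∈ H₂`, `b ≠ 1`, has `(b - 1) i j ≠ 0` for some `i, j < k`.  Then for no proper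
nonzero subspace `W ≤ 𝔽_p^m` does `H₂` contain the unipotent radical
`U_W = {b : b|_W = id, (b - 1) V ≤ W}` of the stabiliser of `W`: the radical transvection
`1 + f(·) w₀` of `NoRadicalMiddle.exists_radical_elem` (with the adapted pair of
`NoRadicalMiddle.exists_adapted_pair`) lies in `U_W`, is nontrivial, and has identity top-left
block. -/
theorem stub_levelKNoRadicalMiddle :
    ∀ (p : ℕ) [Fact p.Prime] (m k : ℕ), 2 * k < m →
      ∀ (H₂ : Subgroup (Matrix.GeneralLinearGroup (Fin m) (ZMod p))),
      (∀ b ∈ H₂, b ≠ 1 →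
        ∃ i j : Fin m, i.val < k ∧ j.val < k ∧
          (((b : Matrix.GeneralLinearGroup (Fin m) (ZMod p)) : Matrix (Fin m) (Fin m) (ZMod p)) - 1) i j ≠ 0) →
      ∀ W : Submodule (ZMod p) (Fin m → ZMod p), W ≠ ⊥ → W ≠ ⊤ →
        (∀ b : Matrix.GeneralLinearGroup (Fin m) (ZMod p),
          (∀ w ∈ W, (b : Matrix (Fin m) (Fin m) (ZMod p)).mulVec w = w) →
          (∀ x : Fin m → ZMod p, (b : Matrix (Fin m) (Fin m) (ZMod p)).mulVec x - x ∈ W) → b ∈ H₂) →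
        False := by
  intro p _ m k hkm H₂ hcorner W hbot htop hrad
  obtain ⟨w₀, hw₀W, hw₀, f, hf, hfW, hblock⟩ := exists_adapted_pair hkm hbot htop
  obtain ⟨b, hfix, hmove, hb1, hzero⟩ := exists_radical_elem k W hw₀W hw₀ hf hfW hblock
  obtain ⟨i, j, hi, hj, hne⟩ := hcorner b (hrad b hfix hmove) hb1
  exact hne (hzero i j hi hj)

end Summit.MatrixMultiplication.MatrixMultiplication.Theorems.SubgroupIdentityDesigns.Negative
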